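import Summits.QuantumFields.YangMills.Theorems.AllWindowsColdBoxDirichletCombBounds

/-!
# LINE-18 v5 of crux `BulkMidWindowSU2` (stmt-QuantumFields-24006), toward half 1 of stub S4 (`K1 → C → K2`, `DirResponseL1`) — part 1/3:
# LINEAR per-edge comb bounds for the temporal-gauge Dirichlet box

Same abstract setting as `Theorems/AllWindowsColdBoxDirichletCombBounds.lean` (stub D of LINE-17): a real edge configuration `s` on `ℤ⁴` vanishing
off the cold box `boxEdges 4 (2H+1)` (`hout`) and on the interior temporal forest (`hforest`).  There the comb identities were squared (Cauchy–Schwarz)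
for the ℓ² Poincaré inequality; here they are used LINEARLY (triangle inequality only, no `(2H+1)` loss), which is the form needed for the
response bound K2 `DirResponseL1` of LINE-18: the covariance edge function `e ↦ Cov_D(dirCirc_x, s_e)` is itself an admissible configuration whose
circulations are the kernel entries `K_H(x, ·)` (part 3), so `Σ_e |Cov_D(dirCirc_x, s_e)| ≤ C·H·Σ_q |K_H(x,q)|` follows from
* `abs_temporal_le` — `t ≥ 1`: `|s((t,z),0)| ≤ Σ_j (|circ((t,z−e_j);0,j+1)| + |circ((t,z);0,j+1)|)`;
* `abs_spatial_le` — `t ≥ 1`: `|s((t,y),i+1)| ≤ Σ_{t'∈[1,2H]} |circ((t',y);0,i+1)| + Σ_{t'} Φ(t',y) + Σ_{t'} Φ(t',y+e_i)` for any majorant `Φ` of the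
  temporal edges at heights `≥ 1`;
* `abs_bottom_temporal_le` — `|s((0,z),0)| ≤ Σ_{k ≤ 2H} [|circ((0,z+ke₁);0,1)| + |circ((−1,z+ke₁);0,1)| + Ψ(z+ke₁)]` for any majorant `Ψ` of the
  height-one spatial edges in direction `1` (`z₀ ≥ 0`).
Everything proved, no definition, standard axioms.  HONEST LABEL: helper toward one half of a registered bundle stub of a critic-passed line on the
R2ξ″ RECORD-rung crux 24006; no stub, crux, rung or summit is proved; the Clay Yang–Mills mass gap is NOT proved by any of this.
-/

set_option autoImplicit false

noncomputable section

open Finset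
open Literature.Probability.LatticeModels (Site mem_halfOpenBox halfOpenBox)
open Literature.MathematicalPhysics.QuantumFieldTheory
open Literature.MathematicalPhysics.QuantumFieldTheory.LatticeMaxwell
open Literature.MathematicalPhysics.QuantumFieldTheory.AxialGauge

namespace Summit.QuantumFields.YangMills.Theorems.AllWindowsColdBox.DirPoincare

open Summit.QuantumFields.YangMills.Theorems.WeakCouplingRates

section Config

variable {H : ℕ} (s : Literature.MathematicalPhysics.QuantumLattice.ZdEdge 4 → ℝ)
  (hout : ∀ e, e ∉ boxEdges 4 (2 * H + 1) → s e = 0)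
  (hforest : ∀ x : Site 4, (∀ k : Fin 4, 1 ≤ x k ∧ x k + 1 ≤ 2 * (H : ℤ)) → s (x, 0) = 0)

include hout hforest in
/-- **Temporal edges at height `t ≥ 1`, linear form**: `|s((t,z),0)| ≤ Σ_j (|circ((t, z − e_j); 0, j+1)| + |circ((t,z); 0, j+1)|)`. -/
theorem abs_temporal_le (t : ℤ) (ht : 1 ≤ t) (z : Fin 3 → ℤ) :
    |s (Fin.cons t z, 0)| ≤
      ∑ j : Fin 3, (|sCirc s (Fin.cons t (z - Pi.single j 1), 0, j.succ)| + |sCirc s (Fin.cons t z, 0, j.succ)|) := by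
  set F : Fin 3 → ℝ := fun j => |sCirc s (Fin.cons t (z - Pi.single j 1), 0, j.succ)| +
    |sCirc s (Fin.cons t z, 0, j.succ)| with hF
  have hFn : ∀ j, 0 ≤ F j := fun j => by simp only [hF]; positivity
  have hnn : 0 ≤ ∑ j : Fin 3, F j := Finset.sum_nonneg fun j _ => hFn j
  by_cases htop : 2 * (H : ℤ) ≤ t
  · rw [s_cons_zero_eq_zero_of_top s hout htop, abs_zero]; exact hnn
  by_cases hsp : ∃ k : Fin 3, z k < 0 ∨ 2 * (H : ℤ) < z k
  · obtain ⟨k, hk⟩ := hsp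
    rw [s_cons_eq_zero_of_space s hout t hk, abs_zero]; exact hnn
  push Not at hsp
  by_cases hin : ∀ k : Fin 3, 1 ≤ z k ∧ z k + 1 ≤ 2 * (H : ℤ)
  · rw [s_cons_zero_eq_zero_of_interior s hforest ⟨ht, by omega⟩ hin, abs_zero]; exact hnn
  push Not at hin
  obtain ⟨j, hj⟩ := hin
  have hzj := hsp j
  have hface : z j = 0 ∨ z j = 2 * (H : ℤ) := by omega
  refine le_trans ?_ (le_sum_fin_three F hFn j)
  rcases hface with hj0 | hj2
  · have hc : sCirc s (Fin.cons t (z - Pi.single j 1), 0, j.succ) = - s (Fin.cons t z, 0) := by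
      rw [sCirc_cons]
      have e1 : s (Fin.cons t (z - Pi.single j 1), 0) = 0 :=
        s_cons_eq_zero_of_space s hout t (k := j) (Or.inl (by simp [hj0])) _
      have e2 : s (Fin.cons (t + 1) (z - Pi.single j 1), j.succ) = 0 :=
        s_cons_eq_zero_of_space s hout (t + 1) (k := j) (Or.inl (by simp [hj0])) _
      have e3 : z - Pi.single j 1 + Pi.single j 1 = z := by simp
      have e4 : s (Fin.cons t (z - Pi.single j 1), j.succ) = 0 :=
        s_cons_eq_zero_of_space s hout t (k := j) (Or.inl (by simp [hj0])) _
      rw [e1, e2, e3, e4]; ring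
    have h1 : |s (Fin.cons t z, 0)| = |sCirc s (Fin.cons t (z - Pi.single j 1), 0, j.succ)| := by rw [hc, abs_neg]
    rw [h1, hF]
    exact le_add_of_nonneg_right (abs_nonneg _)
  · have hc : sCirc s (Fin.cons t z, 0, j.succ) = s (Fin.cons t z, 0) := by
      rw [sCirc_cons]
      have e2 : s (Fin.cons (t + 1) z, j.succ) = 0 := s_cons_succ_eq_zero_of_face s hout (t + 1) (by omega)
      have e3 : s (Fin.cons t (z + Pi.single j 1), 0) = 0 :=
        s_cons_eq_zero_of_space s hout t (k := j) (Or.inr (by simp [hj2])) _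
      have e4 : s (Fin.cons t z, j.succ) = 0 := s_cons_succ_eq_zero_of_face s hout t (by omega)
      rw [e2, e3, e4]; ring
    have h1 : |s (Fin.cons t z, 0)| = |sCirc s (Fin.cons t z, 0, j.succ)| := by rw [hc]
    rw [h1, hF]
    exact le_add_of_nonneg_left (abs_nonneg _)

include hout in
/-- **Spatial edges by the vertical strip, linear form**: for `t ≥ 1`, direction `i+1`, any `y`, given any majorant `Φ t' z ≥ |s((t',z),0)|`
for `t' ≥ 1`, `|s((t,y), i+1)| ≤ Σ_{t'∈[1,2H]} |circ((t',y);0,i+1)| + Σ_{t'} Φ t' y + Σ_{t'} Φ t' (y+e_i)`. -/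
theorem abs_spatial_le (Φ : ℤ → (Fin 3 → ℤ) → ℝ) (hΦ0 : ∀ t z, 0 ≤ Φ t z)
    (hΦ : ∀ t : ℤ, 1 ≤ t → ∀ z, |s (Fin.cons t z, 0)| ≤ Φ t z)
    (t : ℕ) (ht : 1 ≤ t) (y : Fin 3 → ℤ) (i : Fin 3) :
    |s (Fin.cons (t : ℤ) y, i.succ)| ≤
      ∑ t' ∈ Finset.Icc 1 (2 * H), |sCirc s (Fin.cons (t' : ℤ) y, 0, i.succ)| +
        ∑ t' ∈ Finset.Icc 1 (2 * H), Φ t' y + ∑ t' ∈ Finset.Icc 1 (2 * H), Φ t' (y + Pi.single i 1) := by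
  have hS0 : 0 ≤ ∑ t' ∈ Finset.Icc 1 (2 * H), |sCirc s (Fin.cons (t' : ℤ) y, 0, i.succ)| :=
    Finset.sum_nonneg fun _ _ => abs_nonneg _
  have hA0 : 0 ≤ ∑ t' ∈ Finset.Icc 1 (2 * H), Φ t' y := Finset.sum_nonneg fun _ _ => hΦ0 _ _
  have hB0 : 0 ≤ ∑ t' ∈ Finset.Icc 1 (2 * H), Φ t' (y + Pi.single i 1) := Finset.sum_nonneg fun _ _ => hΦ0 _ _
  by_cases htop : 2 * H < t
  · rw [s_cons_eq_zero_of_time s hout (t := (t : ℤ)) (Or.inr (by exact_mod_cast htop)), abs_zero]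
    positivity
  push Not at htop
  set n : ℕ := 2 * H + 1 - t with hn
  have htn : t + n = 2 * H + 1 := by omega
  set a : ℕ → ℝ := fun m => s (Fin.cons ((t : ℤ) + m) y, i.succ) with ha
  set b : ℕ → ℝ := fun m => s (Fin.cons ((t : ℤ) + m) y, 0) with hb
  set b' : ℕ → ℝ := fun m => s (Fin.cons ((t : ℤ) + m) (y + Pi.single i 1), 0) with hb'
  set c : ℕ → ℝ := fun m => sCirc s (Fin.cons ((t : ℤ) + m) y, 0, i.succ) with hc
  have hstep : ∀ m : ℕ, c m = b m + a (m + 1) - b' m - a m := fun m => by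
    simp only [hc, ha, hb, hb', sCirc_cons, Nat.cast_add, Nat.cast_one]
    ring_nf
  have htel : ∑ m ∈ Finset.range n, (a (m + 1) - a m) = a n - a 0 := Finset.sum_range_sub a n
  have han : a n = 0 := by
    simp only [ha]
    exact s_cons_eq_zero_of_time s hout (Or.inr (by omega)) _ _
  have ha0 : a 0 = s (Fin.cons (t : ℤ) y, i.succ) := by simp [ha]
  have hid : s (Fin.cons (t : ℤ) y, i.succ) =
      -(∑ m ∈ Finset.range n, c m) + (∑ m ∈ Finset.range n, b m) + (-(∑ m ∈ Finset.range n, b' m)) := by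
    have : ∑ m ∈ Finset.range n, c m =
        ∑ m ∈ Finset.range n, b m + ∑ m ∈ Finset.range n, (a (m + 1) - a m) - ∑ m ∈ Finset.range n, b' m := by
      rw [← Finset.sum_add_distrib, ← Finset.sum_sub_distrib]
      exact Finset.sum_congr rfl fun m _ => by rw [hstep]; ring
    rw [this, htel, han, ha0]; ring
  -- the three partial sums are dominated by the full families
  have hc_le : ∑ m ∈ Finset.range n, |c m| ≤ ∑ t' ∈ Finset.Icc 1 (2 * H), |sCirc s (Fin.cons (t' : ℤ) y, 0, i.succ)| := by
    have := sum_range_shift_le (H := H) (fun k => |sCirc s (Fin.cons (k : ℤ) y, 0, i.succ)|) (fun _ => abs_nonneg _) ht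
      (le_of_eq htn)
    simpa only [hc, Nat.cast_add] using this
  have hb_le : ∑ m ∈ Finset.range n, |b m| ≤ ∑ t' ∈ Finset.Icc 1 (2 * H), Φ t' y := by
    have hbm : ∀ m ∈ Finset.range n, |b m| ≤ Φ ((t + m : ℕ) : ℤ) y := fun m _ => by
      simp only [hb]; push_cast; exact hΦ _ (by omega) _
    refine (Finset.sum_le_sum hbm).trans ?_
    exact sum_range_shift_le (H := H) (fun k => Φ k y) (fun _ => hΦ0 _ _) ht (le_of_eq htn)
  have hb'_le : ∑ m ∈ Finset.range n, |b' m| ≤ ∑ t' ∈ Finset.Icc 1 (2 * H), Φ t' (y + Pi.single i 1) := by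
    have hbm : ∀ m ∈ Finset.range n, |b' m| ≤ Φ ((t + m : ℕ) : ℤ) (y + Pi.single i 1) := fun m _ => by
      simp only [hb']; push_cast; exact hΦ _ (by omega) _
    refine (Finset.sum_le_sum hbm).trans ?_
    exact sum_range_shift_le (H := H) (fun k => Φ k (y + Pi.single i 1)) (fun _ => hΦ0 _ _) ht (le_of_eq htn)
  rw [hid]
  calc |-(∑ m ∈ Finset.range n, c m) + (∑ m ∈ Finset.range n, b m) + (-(∑ m ∈ Finset.range n, b' m))|
      ≤ |-(∑ m ∈ Finset.range n, c m) + (∑ m ∈ Finset.range n, b m)| + |-(∑ m ∈ Finset.range n, b' m)| := abs_add_le _ _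
    _ ≤ |-(∑ m ∈ Finset.range n, c m)| + |∑ m ∈ Finset.range n, b m| + |-(∑ m ∈ Finset.range n, b' m)| := by
        gcongr; exact abs_add_le _ _
    _ = |∑ m ∈ Finset.range n, c m| + |∑ m ∈ Finset.range n, b m| + |∑ m ∈ Finset.range n, b' m| := by
        rw [abs_neg, abs_neg]
    _ ≤ ∑ m ∈ Finset.range n, |c m| + ∑ m ∈ Finset.range n, |b m| + ∑ m ∈ Finset.range n, |b' m| := by
        gcongr <;> exact Finset.abs_sum_le_sum_abs _ _
    _ ≤ _ := by linarith

include hout in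
/-- **Bottom temporal («Polyakov») edges by the transverse sweep, linear form**: for `z₀ ≥ 0` and any majorant `Ψ w ≥ |s((1,w), 1)|`,
`|s((0,z),0)| ≤ Σ_{k ≤ 2H} [|circ((0, z+k e₁); 0,1)| + |circ((−1, z+k e₁); 0,1)| + Ψ(z + k e₁)]`. -/
theorem abs_bottom_temporal_le (Ψ : (Fin 3 → ℤ) → ℝ)
    (hΨ : ∀ w, |s (Fin.cons 1 w, (0 : Fin 3).succ)| ≤ Ψ w) (z : Fin 3 → ℤ) (hz : 0 ≤ z 0) :
    |s (Fin.cons 0 z, 0)| ≤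
      ∑ k ∈ Finset.range (2 * H + 1),
        (|sCirc s (Fin.cons 0 (z + Pi.single 0 (k : ℤ)), 0, (0 : Fin 3).succ)| +
          |sCirc s (Fin.cons (-1) (z + Pi.single 0 (k : ℤ)), 0, (0 : Fin 3).succ)| + Ψ (z + Pi.single 0 (k : ℤ))) := by
  set K : ℕ := 2 * H + 1 with hK
  set w : ℕ → (Fin 3 → ℤ) := fun k => z + Pi.single 0 (k : ℤ) with hw
  set bt : ℕ → ℝ := fun k => s (Fin.cons 0 (w k), 0) with hbt
  set u : ℕ → ℝ := fun k => s (Fin.cons 1 (w k), (0 : Fin 3).succ) with hu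
  set d : ℕ → ℝ := fun k => s (Fin.cons 0 (w k), (0 : Fin 3).succ) with hd
  set c : ℕ → ℝ := fun k => sCirc s (Fin.cons 0 (w k), 0, (0 : Fin 3).succ) with hc
  have hwsucc : ∀ k : ℕ, w k + Pi.single 0 1 = w (k + 1) := fun k => by
    simp only [hw, add_assoc, ← Pi.single_add]; push_cast; rfl
  have hstep : ∀ k : ℕ, c k = bt k + u k - bt (k + 1) - d k := fun k => by
    simp only [hc, hbt, hu, hd, sCirc_cons, hwsucc]; norm_num
  have htel : ∑ k ∈ Finset.range K, (bt (k + 1) - bt k) = bt K - bt 0 := Finset.sum_range_sub bt K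
  have hbtK : bt K = 0 := by
    simp only [hbt, hw]
    exact s_cons_eq_zero_of_space s hout 0 (k := 0) (Or.inr (by simp; omega)) _
  have hbt0 : bt 0 = s (Fin.cons 0 z, 0) := by simp [hbt, hw]
  have hid : s (Fin.cons 0 z, 0) = ∑ k ∈ Finset.range K, (c k + (-u k) + d k) := by
    have : ∑ k ∈ Finset.range K, (c k + (-u k) + d k) = -∑ k ∈ Finset.range K, (bt (k + 1) - bt k) := by
      rw [← Finset.sum_neg_distrib]
      exact Finset.sum_congr rfl fun k _ => by rw [hstep]; ring
    rw [this, htel, hbtK, hbt0]; ring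
  have hdk : ∀ k, d k = sCirc s (Fin.cons (-1) (w k), 0, (0 : Fin 3).succ) := fun k => by
    simp only [hd]; exact s_bottom_spatial_eq s hout _ _
  rw [hid]
  refine (Finset.abs_sum_le_sum_abs _ _).trans (Finset.sum_le_sum fun k _ => ?_)
  have huk : |u k| ≤ Ψ (w k) := hΨ (w k)
  calc |c k + -u k + d k| ≤ |c k + -u k| + |d k| := abs_add_le _ _
    _ ≤ |c k| + |-u k| + |d k| := by gcongr; exact abs_add_le _ _
    _ = |c k| + |u k| + |d k| := by rw [abs_neg]
    _ ≤ |c k| + |sCirc s (Fin.cons (-1) (w k), 0, (0 : Fin 3).succ)| + Ψ (w k) := by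
        rw [hdk k]; linarith [abs_nonneg (sCirc s (Fin.cons (-1) (w k), 0, (0 : Fin 3).succ))]

end Config

end Summit.QuantumFields.YangMills.Theorems.AllWindowsColdBox.DirPoincare

end
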